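import Summits.AnomalousDissipation.AnomalousDissipation.Theses.TameDichotomy
import Literature.ModelTheory.ExponentialFields.OMinimalDefinability
import Literature.ModelTheory.ExponentialFields.OMinimalMonotonicityReal

/-!
# Line `euler_limit` for the crux `TameDichotomy.TameSteadyWitness` (stmt-AnomalousDissipation-2850)
# — the Euler-limit split as a registered skeleton (crux-strategist, 2026-08-17)

`X = TameSteadyWitness` is an `∃` over a family carrying independent burdens, so exactly one stub stays
existential and the other two are laws over the class it produces:

* `stub_tameEulerDissipator` (X₁, hardest-but-one, Euler level): a smooth steady div-free mean-zero
  `f`, an o-minimal expansion `L` of the real ordered field and an `L`-definable `ū ∈ L²(T³)`, weakly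
  div-free, steady weak (pressure-free) Euler solution with force `f`, ABSORBING POWER `∫⟪f,ū⟫ > 0`.
* `stub_tameViscousRealisation` (X₂, hardest, Navier–Stokes level): every such tame dissipator is the
  a.e. vanishing-viscosity limit of an o-minimally definable bounded-energy family of classical steady
  `NS_ν(f)` states, `ν ∈ (0,δ)`.
* `stub_powerContinuity` (X₃, routine, Vitali): along such a family `∫⟪f,u_ν⟫ → ∫⟪f,ū⟫`.
* `TameSteadyWitness_of : X₁ → X₂ → X₃ → TameSteadyWitness` — REAL PROOF (steady energy identity
  `ν‖∇u_ν‖² = ∫⟪f,u_ν⟫` from `Torus.IsClassicalNSSolutionOn.energy_eq`; positive limit ⇒ floor `l/2`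
  on some `(0,δ₁)`; restriction to `(0, min δ δ₁)` with the definable graph cut by the definable
  half-space `v 0 < min δ δ₁`).

The three stub signatures are character-for-character the children of the prepared
`route edit --split TameSteadyWitness` (`Cruxes/TameSteadyWitness/SPLIT.md`) and the defs of
`Lines/euler_limit_split_assembly.lean`; per-piece birth skeletons are `Lines/birth_<Piece>.lean`.
BC2 probes `Xᵢ → S`, `Xᵢ → X`, `S → Xᵢ`, `X → Xᵢ` (`exact? | simpa | aesop`): 12/12 fail.
`sorry` only in the three `stub_*`.
-/

set_option linter.dupNamespace false

noncomputable section

namespace Summit.AnomalousDissipation.AnomalousDissipation.Cruxes.TameSteadyWitness.EulerLimit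

open scoped Topology InnerProductSpace
open Filter Set MeasureTheory
open Summit.AnomalousDissipation.AnomalousDissipation.Theses.TameDichotomy
open Literature.Analysis.FunctionSpaces Literature.ModelTheory.ExponentialFields

/-- Signature of `stub_tameEulerDissipator` (X₁ — TAME EULER DISSIPATOR). -/
def Sig.stub_tameEulerDissipator : Prop :=
  ∃ f : UnitAddTorus (Fin 3) → EuclideanSpace ℝ (Fin 3), Literature.Analysis.FunctionSpaces.Torus.IsSmooth f ∧ Literature.Analysis.FunctionSpaces.Torus.IsDivFree f ∧ Literature.Analysis.FunctionSpaces.Torus.HasZeroMean f ∧ ∃ (L : FirstOrder.Language.{0, 0}) (_ : L.Structure ℝ) (φ : FirstOrder.Language.LHom Literature.ModelTheory.ExponentialFields.Language.orderedRing L) (_ : φ.IsExpansionOn ℝ), L.IsOMinimal ℝ ∧ ∃ ū : UnitAddTorus (Fin 3) → EuclideanSpace ℝ (Fin 3), (Set.univ : Set ℝ).Definable L {v : Fin 6 → ℝ | v 0 ∈ Set.Ico (0 : ℝ) 1 ∧ v 1 ∈ Set.Ico (0 : ℝ) 1 ∧ v 2 ∈ Set.Ico (0 : ℝ) 1 ∧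 v 3 = ū (Literature.Analysis.FunctionSpaces.Torus.proj !₂[v 0, v 1, v 2]) 0 ∧ v 4 = ū (Literature.Analysis.FunctionSpaces.Torus.proj !₂[v 0, v 1, v 2]) 1 ∧ v 5 = ū (Literature.Analysis.FunctionSpaces.Torus.proj !₂[v 0, v 1, v 2]) 2} ∧ MeasureTheory.MemLp ū 2 MeasureTheory.volume ∧ Literature.Analysis.FunctionSpaces.Torus.IsWeaklyDivFree ū ∧ (∀ w : UnitAddTorus (Fin 3) → EuclideanSpace ℝ (Fin 3), Literature.Analysis.FunctionSpaces.Torus.IsSmooth w → Literature.Analysis.FunctionSpaces.Torus.IsDivFree w → ∫ x, inner ℝ (ū x) (Literature.Analysis.FunctionSpaces.Torus.convect ū w x) + ∫ x, inner ℝ (f x) (w x) = 0) ∧ 0 < ∫ x, inner ℝ (f x) (ū x)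

/-- Signature of `stub_tameViscousRealisation` (X₂ — TAME VISCOUS REALISATION). -/
def Sig.stub_tameViscousRealisation : Prop :=
  ∀ (L : FirstOrder.Language.{0, 0}) [L.Structure ℝ] (φ : FirstOrder.Language.LHom Literature.ModelTheory.ExponentialFields.Language.orderedRing L) [φ.IsExpansionOn ℝ], L.IsOMinimal ℝ → ∀ f : UnitAddTorus (Fin 3) → EuclideanSpace ℝ (Fin 3), Literature.Analysis.FunctionSpaces.Torus.IsSmooth f → Literature.Analysis.FunctionSpaces.Torus.IsDivFree f → Literature.Analysis.FunctionSpaces.Torus.HasZeroMean f → ∀ ū : UnitAddTorus (Fin 3) → EuclideanSpace ℝ (Fin 3), (Set.univ : Set ℝ).Definable L {v : Fin 6 → ℝ | v 0 ∈ Set.Ico (0 : ℝ) 1 ∧ v 1 ∈ Set.Ico (0 : ℝ) 1 ∧ v 2 ∈ Set.Ico (0 : ℝ) 1 ∧ v 3 = ū (Literature.Analysis.FunctionSpaces.Torus.proj !₂[v 0, v 1, v 2]) 0 ∧ v 4 = ū (Literature.Analysis.FunctionSpaces.Torus.proj !₂[v 0, v 1, v 2]) 1 ∧ v 5 = ū (Literature.Analysis.FunctionSpaces.Torus.proj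 !₂[v 0, v 1, v 2]) 2} → MeasureTheory.MemLp ū 2 MeasureTheory.volume → Literature.Analysis.FunctionSpaces.Torus.IsWeaklyDivFree ū → (∀ w : UnitAddTorus (Fin 3) → EuclideanSpace ℝ (Fin 3), Literature.Analysis.FunctionSpaces.Torus.IsSmooth w → Literature.Analysis.FunctionSpaces.Torus.IsDivFree w → ∫ x, inner ℝ (ū x) (Literature.Analysis.FunctionSpaces.Torus.convect ū w x) + ∫ x, inner ℝ (f x) (w x) = 0) → 0 < ∫ x, inner ℝ (f x) (ū x) → ∃ (L' : FirstOrder.Language.{0, 0}) (_ : L'.Structure ℝ) (φ' : FirstOrder.Language.LHom Literature.ModelTheory.ExponentialFields.Language.orderedRing L') (_ : φ'.IsExpansionOn ℝ), L'.IsOMinimal ℝ ∧ ∃ (δ : ℝ) (u : ℝ → UnitAddTorus (Fin 3) → EuclideanSpace ℝ (Fin 3)) (p : ℝ → UnitAddTorus (Fin 3) → ℝ), 0 < δ ∧ (Set.univ : Set ℝ).Definable L' {v : Fin 7 → ℝ | v 0 ∈ Set.Ioo 0 δ ∧ v 1 ∈ Set.Ico (0 : ℝ) 1 ∧ v 2 ∈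 Set.Ico (0 : ℝ) 1 ∧ v 3 ∈ Set.Ico (0 : ℝ) 1 ∧ v 4 = u (v 0) (Literature.Analysis.FunctionSpaces.Torus.proj !₂[v 1, v 2, v 3]) 0 ∧ v 5 = u (v 0) (Literature.Analysis.FunctionSpaces.Torus.proj !₂[v 1, v 2, v 3]) 1 ∧ v 6 = u (v 0) (Literature.Analysis.FunctionSpaces.Torus.proj !₂[v 1, v 2, v 3]) 2} ∧ (∀ ν ∈ Set.Ioo 0 δ, Literature.Analysis.FunctionSpaces.Torus.IsClassicalNSSolutionOn Set.univ ν (fun _ => f) (fun _ => u ν) (fun _ => p ν)) ∧ (∃ E : ℝ, ∀ ν ∈ Set.Ioo 0 δ, ∫ x, ‖u ν x‖ ^ 2 ≤ E) ∧ ∀ᵐ x, Filter.Tendsto (fun ν => u ν x) (nhdsWithin 0 (Set.Ioi 0)) (nhds (ū x))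

/-- Signature of `stub_powerContinuity` (X₃ — POWER CONTINUITY, Vitali). -/
def Sig.stub_powerContinuity : Prop :=
  ∀ (f : UnitAddTorus (Fin 3) → EuclideanSpace ℝ (Fin 3)), Literature.Analysis.FunctionSpaces.Torus.IsSmooth f → ∀ (δ : ℝ) (u : ℝ → UnitAddTorus (Fin 3) → EuclideanSpace ℝ (Fin 3)) (ū : UnitAddTorus (Fin 3) → EuclideanSpace ℝ (Fin 3)), 0 < δ → (∀ ν ∈ Set.Ioo 0 δ, Literature.Analysis.FunctionSpaces.Torus.IsSmooth (u ν)) → (∃ E : ℝ, ∀ ν ∈ Set.Ioo 0 δ, ∫ x, ‖u ν x‖ ^ 2 ≤ E) → (∀ᵐ x, Filter.Tendsto (fun ν => u ν x) (nhdsWithin 0 (Set.Ioi 0)) (nhds (ū x))) → Filter.Tendsto (fun ν => ∫ x, inner ℝ (f x) (u ν x)) (nhdsWithin 0 (Set.Ioi 0)) (nhds (∫ x, inner ℝ (f x) (ū x)))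

/-- STUB X₁ (open, Euler level). -/
theorem stub_tameEulerDissipator : Sig.stub_tameEulerDissipator := by
  sorry

/-- STUB X₂ (open, Navier–Stokes level; hardest). -/
theorem stub_tameViscousRealisation : Sig.stub_tameViscousRealisation := by
  sorry

/-- STUB X₃ (true, routine: Vitali's convergence theorem). -/
theorem stub_powerContinuity : Sig.stub_powerContinuity := by
  sorry

theorem steady_energy_identity {ν : ℝ} {f u : UnitAddTorus (Fin 3) → EuclideanSpace ℝ (Fin 3)}
    {p : UnitAddTorus (Fin 3) → ℝ}
    (h : Torus.IsClassicalNSSolutionOn Set.univ ν (fun _ => f) (fun _ => u) (fun _ => p)) :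
    ν * Torus.gradNormSq u = ∫ x, inner ℝ (f x) (u x) := by
  have hE := h.energy_eq convex_univ (zero_le_one (α := ℝ)) (Set.subset_univ _)
  simp only [intervalIntegral.integral_const, sub_zero, one_smul] at hE
  linarith

/-- COMPOSITION (real proof): `X₁ → X₂ → X₃ → TameSteadyWitness`, concluding the crux BY NAME. -/
theorem TameSteadyWitness_of (h₁ : Sig.stub_tameEulerDissipator) (h₂ : Sig.stub_tameViscousRealisation)
    (h₃ : Sig.stub_powerContinuity) :
    Summit.AnomalousDissipation.AnomalousDissipation.Theses.TameDichotomy.TameSteadyWitness := by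
  obtain ⟨f, hf, hdiv, hmean, L, instL, φ, instφ, hO, ū, hdef, hL2, hwdiv, hEuler, hpos⟩ := h₁
  -- realise the tame Euler dissipator by a tame steady Navier–Stokes family (X₂)
  obtain ⟨L', instL', φ', instφ', hO', δ, u, p, hδ, hdefu, hsol, hE, hae⟩ :=
    @h₂ L instL φ instφ hO f hf hdiv hmean ū hdef hL2 hwdiv hEuler hpos
  -- the absorbed power converges (X₃) ...
  have hsm : ∀ ν ∈ Set.Ioo 0 δ, Torus.IsSmooth (u ν) := fun ν hν =>
    (hsol ν hν).smooth_velocity.isSmooth_slice (Set.mem_univ (0 : ℝ))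
  have hP : Tendsto (fun ν => ∫ x, inner ℝ (f x) (u ν x)) (𝓝[>] 0)
      (𝓝 (∫ x, inner ℝ (f x) (ū x))) :=
    h₃ f hf δ u ū hδ hsm hE hae
  -- ... and equals the dissipation on `(0, δ)` (steady energy identity), so the dissipation converges
  have hD : Tendsto (fun ν => ν * Torus.gradNormSq (u ν)) (𝓝[>] 0)
      (𝓝 (∫ x, inner ℝ (f x) (ū x))) := by
    refine hP.congr' ?_
    filter_upwards [Ioo_mem_nhdsGT hδ] with ν hν
    exact (steady_energy_identity (hsol ν hν)).symm
  -- a positive limit gives the floor `l / 2` on some `(0, δ₁)`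
  set l : ℝ := ∫ x, inner ℝ (f x) (ū x) with hl
  have hev : ∀ᶠ ν in 𝓝[>] (0 : ℝ), l / 2 < ν * Torus.gradNormSq (u ν) :=
    hD.eventually_const_lt (by linarith)
  obtain ⟨δ₁, hδ₁, hsub⟩ := mem_nhdsGT_iff_exists_Ioo_subset.1 hev
  have hδ₁' : (0 : ℝ) < δ₁ := hδ₁
  -- restrict everything to `(0, δ')`, `δ' = min δ δ₁`
  refine ⟨f, hf, hdiv, hmean, L', instL', φ', instφ', hO', min δ δ₁, u, p, lt_min hδ hδ₁',
    ?_, ?_, ?_, l / 2, by linarith, ?_⟩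
  · -- the graph over `(0, δ')` is the graph over `(0, δ)` cut by the definable half-space `v 0 < δ'`
    have hlt := definable_lt_of_expansion (M := ℝ) φ'
    have hhalf : (Set.univ : Set ℝ).Definable L' {v : Fin 7 → ℝ | v 0 < min δ δ₁} :=
      definable_setOf_lt hlt (definableFun_proj 0) (definableFun_const' _ _)
    convert hdefu.inter hhalf using 1
    ext v
    simp only [Set.mem_setOf_eq, Set.mem_inter_iff, Set.mem_Ioo, lt_min_iff]
    constructor
    · rintro ⟨⟨h0, hδa, hδb⟩, hrest⟩
      exact ⟨⟨⟨h0, hδa⟩, hrest⟩, hδa, hδb⟩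
    · rintro ⟨⟨⟨h0, hδa⟩, hrest⟩, -, hδb⟩
      exact ⟨⟨h0, hδa, hδb⟩, hrest⟩
  · intro ν hν
    exact hsol ν ⟨hν.1, hν.2.trans_le (min_le_left _ _)⟩
  · obtain ⟨E, hE⟩ := hE
    exact ⟨E, fun ν hν => hE ν ⟨hν.1, hν.2.trans_le (min_le_left _ _)⟩⟩
  · intro ν hν
    exact (hsub ⟨hν.1, hν.2.trans_le (min_le_right _ _)⟩).le


/-- The crux modulo the three registered stubs. -/
theorem TameSteadyWitness_proof :
    Summit.AnomalousDissipation.AnomalousDissipation.Theses.TameDichotomy.TameSteadyWitness :=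
  TameSteadyWitness_of stub_tameEulerDissipator stub_tameViscousRealisation stub_powerContinuity

end Summit.AnomalousDissipation.AnomalousDissipation.Cruxes.TameSteadyWitness.EulerLimit

end
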